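import Summits.Ventures.LatticeQCDFlow.Scaling.SimulatedTemperingModeTorpid
import Summits.Ventures.LatticeQCDFlow.Scaling.SimulatedTemperingFiniteFloor

/-!
HONEST FRAMING: exact (Metropolis-corrected) sampling algorithms for lattice gauge theory; figures
of merit are autocorrelation/cost numbers at stated couplings and volumes; no continuum-physics
claim.

# AdjacentLevelSchemeDiffusiveCeiling — SIMULATED TEMPERING IS DIFFUSIVE IN THE NUMBER OF LEVELS WHATEVER THE LEVEL
# PROPOSAL: FOR `P = t·Q + (1−t)·W` WITH `W` THE WITHIN-LEVEL UPDATE AND `Q` ANY `π`-REVERSIBLE LEVEL MOVE THAT CHANGES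
# THE LEVEL BY AT MOST ONE, `Gap(P) ≤ 6t·ρ/(K(K+2)) ≤ 6t/(K(K+2))` (`ρ` = the stationary rate of level changes)
# (lean-2 GEN-20, ours)

Venture-side (OURS).  Cell `lqcd-flow` (pub-lqcd), unit `pub-lqcd-lean-2-g20`, 2026-08-25.  Chapter H (universal
ceilings), the level-scheme companion of `AdjacentSchemeDiffusiveCeiling` (replica exchange, adjacent swaps: order `K³`)
and of `LevelSchemeSectorCeiling` (tunnelling: order `K`).  Setting of `SimulatedTemperingFiniteSampler`: state
`(k, x) ∈ Fin (K+1) × S`, target `π(k,x) = μ_k(x)/(K+1)` (`stFinLaw μ`, exact weights), within-level update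
`W = stFinWithin M` (`M_k` row-stochastic, `μ_k`-reversible), and a LEVEL MOVE `Q`: any row-stochastic `π`-reversible
kernel with `Q(p,q) ≠ 0 ⇒ |q.1 − p.1| ≤ 1` (Metropolis moves with exact or learned weights, moves carrying the
configuration through a map between adjacent couplings as in `SimulatedTemperingFlowSampler`, any acceptance rule).
The test function is the LEVEL itself, `f(k,x) = k`.

## What is proved

* §1 (`SimulatedTemperingFiniteFloor.stFin_lawVariance_level`: `Var_π(k) = K(K+2)/12`, reused by name);
  `stFinWithin_dirichletForm_level` (`𝓔_W(k) = 0`), `adjacent_dirichletForm_level_le`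
  (`𝓔_Q(k) ≤ ½ρ`, `ρ = Σ_p π(p)·Q(p, {level changes}) ≤ 1`).
* §2 **`adjacentLevelScheme_spectralGap_le`**: `Gap(t·Q + (1−t)·W) ≤ 6t·ρ/(K(K+2))` (`0 ≤ t ≤ 1`, `K ≥ 1`);
  **`adjacentLevelScheme_spectralGap_le_six`**: `≤ 6t/(K(K+2))`.

Reading (no numerics implied): a single walker moving one level per step needs order `K²` steps to cross `K+1`
levels whatever proposal, weights, maps or acceptance rule implement the move; with `LevelSchemeSectorCeiling` the
relaxation time of any such exact tempering sampler is at least `max{K(K+2)/(6tρ), (K+1)a(1−a)/((1−t)Q_0(A,Aᶜ))}`.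
NOT CLAIMED: non-adjacent level proposals (they escape this file by design); lifted non-reversible level sweeps
(not reversible); floors; anything measured.  Literature grade (cell rule): KNOWN MECHANISM (diffusive bound for
nearest-neighbour walks; the cell's measure-theoretic `SimulatedTemperingDiffusive` for the standard kernels), NEW
TYPING (finite vocabulary, arbitrary adjacent level move); nothing cited as a fact; no new bib keys.
-/

noncomputable section

open Finset Function
open Literature.Probability.MarkovChains

namespace Summit.Ventures.LatticeQCDFlow.Scaling

variable {S : Type*} [Fintype S] {K : ℕ} {μ : Fin (K + 1) → S → ℝ}
  {M : Fin (K + 1) → Matrix S S ℝ} {t : ℝ} {Q : Matrix (Fin (K + 1) × S) (Fin (K + 1) × S) ℝ}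

/-! ## §1 The level as a test function -/

/-- **The within-level update does not move the level:** `𝓔_W(level) = 0`. [ours] -/
theorem stFinWithin_dirichletForm_level (M : Fin (K + 1) → Matrix S S ℝ) :
    dirichletForm (stFinLaw μ) (stFinWithin M) (fun p : Fin (K + 1) × S => ((p.1 : ℕ) : ℝ)) = 0 := by
  unfold dirichletForm
  rw [Finset.sum_eq_zero fun p _ => Finset.sum_eq_zero fun q _ => ?_, mul_zero]
  rw [stFinWithin_apply]
  split_ifs with h
  · simp [h]
  · ring

/-- **An adjacent level move has `𝓔_Q(level) ≤ ½·ρ`,** `ρ = Σ_p π(p)·Σ_{q : q.1 ≠ p.1} Q(p,q)` the stationary rate of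
level changes (`π, Q ≥ 0`; `Q(p,q) ≠ 0 ⇒ |q.1 − p.1| ≤ 1`). [ours] -/
theorem adjacent_dirichletForm_level_le (hμ : ∀ k x, 0 < μ k x) (hQ0 : ∀ p q, 0 ≤ Q p q)
    (hadj : ∀ p q, Q p q ≠ 0 → ((q.1 : ℕ) = p.1 ∨ (q.1 : ℕ) = p.1 + 1 ∨ (p.1 : ℕ) = q.1 + 1)) :
    dirichletForm (stFinLaw μ) Q (fun p : Fin (K + 1) × S => ((p.1 : ℕ) : ℝ))
      ≤ 1 / 2 * ∑ p, stFinLaw μ p * ∑ q ∈ univ.filter (fun q => q.1 ≠ p.1), Q p q := by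
  unfold dirichletForm
  apply mul_le_mul_of_nonneg_left ?_ (by norm_num : (0 : ℝ) ≤ 1 / 2)
  refine sum_le_sum fun p _ => ?_
  rw [Finset.mul_sum, Finset.sum_filter]
  refine sum_le_sum fun q _ => ?_
  have hπ : 0 ≤ stFinLaw μ p := (stFinLaw_pos hμ p).le
  by_cases hq : Q p q = 0
  · rw [hq]; split_ifs <;> simp
  · by_cases hl : q.1 = p.1
    · rw [if_neg (not_not.mpr hl)]; simp [hl]
    · rw [if_pos hl, mul_assoc]
      refine mul_le_mul_of_nonneg_left ?_ hπ
      have hsq : ((((p.1 : ℕ) : ℝ)) - ((q.1 : ℕ) : ℝ)) ^ 2 ≤ 1 := by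
        rcases hadj p q hq with h | h | h
        · exact absurd (Fin.ext h) hl
        · rw [h]; push_cast; norm_num
        · rw [h]; push_cast; norm_num
      calc Q p q * _ ≤ Q p q * 1 := mul_le_mul_of_nonneg_left hsq (hQ0 p q)
        _ = Q p q := mul_one _

/-- The rate of level changes is at most one (`Q` row-stochastic, `π` a probability vector). [ours] -/
theorem levelChangeRate_le_one (hμ : ∀ k x, 0 < μ k x) (hμ1 : ∀ k, ∑ x, μ k x = 1) (hQ : IsRowStochastic Q) :
    ∑ p, stFinLaw μ p * ∑ q ∈ univ.filter (fun q => q.1 ≠ p.1), Q p q ≤ 1 := by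
  calc ∑ p, stFinLaw μ p * ∑ q ∈ univ.filter (fun q => q.1 ≠ p.1), Q p q ≤ ∑ p, stFinLaw μ p * 1 := by
        refine sum_le_sum fun p _ => mul_le_mul_of_nonneg_left ?_ (stFinLaw_pos hμ p).le
        rw [← hQ.2 p]
        exact sum_le_sum_of_subset_of_nonneg (filter_subset _ _) fun q _ _ => hQ.1 p q
    _ = 1 := by rw [← Finset.sum_mul, sum_stFinLaw hμ1, one_mul]

/-! ## §2 The diffusive ceiling for every adjacent level scheme -/

/-- **SIMULATED TEMPERING IS DIFFUSIVE IN THE NUMBER OF LEVELS, WHATEVER THE LEVEL PROPOSAL:** for `0 ≤ t ≤ 1`,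
`K ≥ 1`, `W = stFinWithin M` and ANY row-stochastic `π`-reversible level move `Q` changing the level by at most one,
`Gap(t·Q + (1−t)·W) ≤ 6t·ρ/(K(K+2))`, `ρ ≤ 1` the stationary rate of level changes. [ours] -/
theorem adjacentLevelScheme_spectralGap_le (hK : 1 ≤ K) (hμ : ∀ k x, 0 < μ k x) (hμ1 : ∀ k, ∑ x, μ k x = 1)
    (hM : ∀ k, IsRowStochastic (M k)) (hMrev : ∀ k, DetailedBalance (μ k) (M k)) (ht0 : 0 ≤ t) (ht1 : t ≤ 1)
    (hQ : IsRowStochastic Q) (hQrev : DetailedBalance (stFinLaw μ) Q)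
    (hadj : ∀ p q, Q p q ≠ 0 → ((q.1 : ℕ) = p.1 ∨ (q.1 : ℕ) = p.1 + 1 ∨ (p.1 : ℕ) = q.1 + 1)) :
    spectralGap (stFinLaw μ) (fun p q : Fin (K + 1) × S => t * Q p q + (1 - t) * stFinWithin M p q)
      ≤ 6 * t * (∑ p, stFinLaw μ p * ∑ q ∈ univ.filter (fun q => q.1 ≠ p.1), Q p q) / (K * (K + 2)) := by
  haveI : Nonempty S := by
    by_contra h
    rw [not_nonempty_iff] at h
    have := hμ1 0
    rw [Finset.univ_eq_empty, Finset.sum_empty] at this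
    exact zero_ne_one this
  haveI : Nontrivial (Fin (K + 1) × S) := by
    obtain ⟨u⟩ := (inferInstance : Nonempty S)
    exact ⟨⟨((0 : Fin (K + 1)), u), (⟨1, by omega⟩, u), by simp [Prod.ext_iff, Fin.ext_iff]⟩⟩
  have hW := stFinWithin_isRowStochastic (K := K) hM
  have hWrev := stFinWithin_detailedBalance (μ := μ) hMrev
  have hP : IsRowStochastic (fun p q : Fin (K + 1) × S => t * Q p q + (1 - t) * stFinWithin M p q) := by
    refine ⟨fun p q => add_nonneg (mul_nonneg ht0 (hQ.1 p q)) (mul_nonneg (by linarith) (hW.1 p q)), fun p => ?_⟩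
    simp only
    rw [Finset.sum_add_distrib, ← Finset.mul_sum, ← Finset.mul_sum, hQ.2 p, hW.2 p]; ring
  have hDB : DetailedBalance (stFinLaw μ) (fun p q : Fin (K + 1) × S => t * Q p q + (1 - t) * stFinWithin M p q) := by
    intro p q
    have h1 := hQrev p q
    have h2 := hWrev p q
    simp only
    linear_combination t * h1 + (1 - t) * h2
  set f : Fin (K + 1) × S → ℝ := fun p => ((p.1 : ℕ) : ℝ) with hf
  have hπ1 := sum_stFinLaw (K := K) hμ1
  have hKpos : (0 : ℝ) < K := Nat.cast_pos.mpr (by omega)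
  have hVar : lawVariance (stFinLaw μ) f = (K : ℝ) * (K + 2) / 12 := stFin_lawVariance_level hμ1
  have hVpos : 0 < lawVariance (stFinLaw μ) f := by rw [hVar]; positivity
  have hsplit : dirichletForm (stFinLaw μ) (fun p q : Fin (K + 1) × S => t * Q p q + (1 - t) * stFinWithin M p q) f
      = t * dirichletForm (stFinLaw μ) Q f + (1 - t) * dirichletForm (stFinLaw μ) (stFinWithin M) f := by
    unfold dirichletForm
    rw [← mul_assoc, ← mul_assoc, mul_comm t, mul_comm (1 - t), mul_assoc, mul_assoc, ← mul_add]
    congr 1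
    rw [Finset.mul_sum, Finset.mul_sum, ← Finset.sum_add_distrib]
    refine sum_congr rfl fun p _ => ?_
    rw [Finset.mul_sum, Finset.mul_sum, ← Finset.sum_add_distrib]
    exact sum_congr rfl fun q _ => by ring
  have hE : dirichletForm (stFinLaw μ) (fun p q : Fin (K + 1) × S => t * Q p q + (1 - t) * stFinWithin M p q) f
      ≤ t * (1 / 2 * ∑ p, stFinLaw μ p * ∑ q ∈ univ.filter (fun q => q.1 ≠ p.1), Q p q) := by
    rw [hsplit, stFinWithin_dirichletForm_level, mul_zero, add_zero]
    exact mul_le_mul_of_nonneg_left (adjacent_dirichletForm_level_le hμ hQ.1 hadj) ht0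
  rw [LevinPeres2017_lemma_13_7 (stFinLaw_pos hμ) hπ1 hP hDB]
  refine (spectralGapR_le_dirichletForm_div_lawVariance (fun p => (stFinLaw_pos hμ p).le) hπ1 hP.1 hVpos).trans ?_
  rw [hVar, div_le_div_iff₀ (by positivity) (by positivity)]
  nlinarith [hE, hKpos]

/-- **`Gap ≤ 6t/(K(K+2))`** — the rate of level changes is at most one. [ours] -/
theorem adjacentLevelScheme_spectralGap_le_six (hK : 1 ≤ K) (hμ : ∀ k x, 0 < μ k x)
    (hμ1 : ∀ k, ∑ x, μ k x = 1) (hM : ∀ k, IsRowStochastic (M k)) (hMrev : ∀ k, DetailedBalance (μ k) (M k))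
    (ht0 : 0 ≤ t) (ht1 : t ≤ 1) (hQ : IsRowStochastic Q) (hQrev : DetailedBalance (stFinLaw μ) Q)
    (hadj : ∀ p q, Q p q ≠ 0 → ((q.1 : ℕ) = p.1 ∨ (q.1 : ℕ) = p.1 + 1 ∨ (p.1 : ℕ) = q.1 + 1)) :
    spectralGap (stFinLaw μ) (fun p q : Fin (K + 1) × S => t * Q p q + (1 - t) * stFinWithin M p q)
      ≤ 6 * t / (K * (K + 2)) := by
  have hKpos : (0 : ℝ) < K := Nat.cast_pos.mpr (by omega)
  refine (adjacentLevelScheme_spectralGap_le hK hμ hμ1 hM hMrev ht0 ht1 hQ hQrev hadj).trans ?_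
  refine div_le_div_of_nonneg_right ?_ (by positivity)
  calc 6 * t * _ ≤ 6 * t * 1 := mul_le_mul_of_nonneg_left (levelChangeRate_le_one hμ hμ1 hQ) (by positivity)
    _ = 6 * t := mul_one _

end Summit.Ventures.LatticeQCDFlow.Scaling

end
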